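import Literature.ComputerArithmetic.Shewchuk1997.FastExpansionSum

/-!
# FAST-EXPANSION-SUM does not preserve the strongly nonoverlapping property:
# Theorem 13 of Shewchuk (1997) is false as printed

HONEST FRAMING (ENGINES group, unit `eng-quad-4`, kernels lane of the `certquad` engine — shared
numerical engines serving client cells; rigour lives in the verifiers; every published number
belongs to a client cell's ledger, not to the engines group): this is NEW WORK of the lane's Lean
line, not a published result, hence it lives under `Summits/Ventures/` and carries no citation tag of
its own.  While typing §2.4 of [Shewchuk1997] verbatim
(`Literature/ComputerArithmetic/Shewchuk1997/FastExpansionSum.lean`: the strongly nonoverlapping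
property `IsStrongExpansion`, the algorithm `fastExpansionSum`, Lemmas 14–16) the conclusion of its
Theorem 13 turned out to be unprovable because it is false; this file proves that.

THE PRINTED STATEMENT (J. R. Shewchuk, *Adaptive precision floating-point arithmetic and fast robust
geometric predicates*, Discrete Comput. Geom. 18 (1997) 305–363, Theorem 13, pp. 319–320): for
strongly nonoverlapping expansions `e`, `f` of `p`-bit components, `p ≥ 4`, sorted by increasing
magnitude except for zeros, "on a machine whose arithmetic uses the round-to-even rule"
FAST-EXPANSION-SUM "will produce a strongly nonoverlapping expansion `h`" with `Σ h = e + f`, sorted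
except for zeros.

THE COUNTEREXAMPLE (every `p ≥ 4`; exponent floor `emin ≤ 0`, i.e. far from underflow; round-to-even
`BoldoJeannerodMelquiondMuller2023.roundTiesEven p emin`).  `e = ⟨2^p + 2⟩` and
`f = ⟨−(2^(p−1) − 1), −2^p⟩` are strongly nonoverlapping (`f` is even nonadjacent).  Line 1 merges
them to `g = ⟨−(2^(p−1) − 1), −2^p, 2^p + 2⟩`.  Line 2: `g₂ + g₁ = −(3·2^(p−1) − 1)` is the exact
midpoint of the consecutive floats `−3·2^(p−1)` and `−(3·2^(p−1) − 2)` (the binade `[2^p, 2^(p+1))`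
has `ulp = 2`), and round-to-even returns `Q₂ = −3·2^(p−1)` (even scaled significand `3·2^(p−2)`),
so `h₁ = 1` (`roundTiesEven_tie`).  Line 4: `Q₂ + g₃ = −(2^(p−1) − 2)` is a float, so
`Q₃ = −(2^(p−1) − 2)` and `h₂ = 0`.  Line 5: `h₃ = Q₃`.  Hence `h = ⟨1, 0, −(2^(p−1) − 2)⟩`
(`fastExpansionSum_ce`, `counterexample_family`): the nonzero components `1` and `−(2^(p−1) − 2)` are
ADJACENT (`2·1 = 2` is a bit of `2^(p−1) − 2 = 2 + 4 + ⋯ + 2^(p−2)`) and `2^(p−1) − 2` is not a power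
of two, so `h` is NOT strongly nonoverlapping (`not_isStrongExpansion_ceH`,
`printedTheorem13_conclusion_false`).  For `p = 4`: `e = ⟨18⟩ = 10010`, `f = ⟨−7, −16⟩`,
`h = ⟨1, 0, −6⟩` (`counterexample_four`).  `h` IS nonoverlapping with the right sum, as Lemmas 14 and
16 (proved in the Literature file for any round-to-nearest) demand (`counterexample_family_nonoverlapping`).

WHERE THE PRINTED PROOF BREAKS (p. 322).  It supposes a first adjacent pair `hᵢ₋₁, hᵢ` of output
components and argues about the TWO-SUM that "computes `hᵢ` by Line 4 from `Qᵢ` and `gᵢ₊₁`", with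
footnote 5: "It is implicitly assumed here that the first offending pair is not separated by
intervening zeros. The proof could be written to consider the case where intervening zeros appear,
but this would make it even more convoluted. Trust me."  In the counterexample the offending pair
`h₁ = 1`, `h₃` IS separated by the zero `h₂`, and `h₃ = Q₃` is written by Line 5, not computed by
Line 4, so Corollary 8(b) never constrains it.  Offending pairs separated by a zero also occur in the
interior of `h`: for `p = 4` the nonadjacent inputs `e = ⟨−22, −64, 768⟩`, `f = ⟨2, 120, 768⟩` give
`h = ⟨0, −4, 0, −24, 64, 1536⟩` (found by an exhaustive search over pairs of short four-bit
expansions with an integer model of round-to-even, re-derived by hand; not formalised here).  In the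
searched range every output was nonoverlapping (as the Literature theorem guarantees), the lower
member of every adjacent output pair was a one-bit number, and no output component was adjacent to
two others; whether this weaker property is preserved in general is left OPEN (nothing is claimed).

CONSEQUENCE.  Downstream the paper uses (i) that `h` is a nonoverlapping expansion with the exact
sum — intact (Lemmas 14 and 16) — and (ii) that `h` may be fed back into FAST-EXPANSION-SUM, whose
hypothesis in Theorem 13 is "strongly nonoverlapping" inputs — and that is what breaks as stated:
`⟨1, 0, −(2^(p−1) − 2)⟩` is a legitimate output which is not a legitimate input of Theorem 13.
Whether FAST-EXPANSION-SUM is nevertheless correct on all of its own outputs (a weaker invariant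
closed under the algorithm) is not decided here.

PROVED HERE (0 sorry, no new definitions): `isStrongExpansion_singleton`, `ceF_isExpansion_two`,
`ceE_isFloat`, `ceF_isFloat`, `roundTiesEven_tie`, `fastExpansionSum_of_merge_three`,
`fastExpansionSum_ce`, `not_isStrongExpansion_ceH`, `counterexample_family`,
`printedTheorem13_conclusion_false`, `counterexample_four`, `counterexample_family_nonoverlapping`.

References: [Shewchuk1997] Thm 13 pp. 319–320, proof pp. 322–323 and footnote 5 (the statement
refuted); the model and the true half are `Literature/ComputerArithmetic/Shewchuk1997/FastExpansionSum.lean`.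
-/

namespace Summit.Ventures.CertifiedArithmetic.Expansions

open Literature.ComputerArithmetic.JeannerodRump2018 (IsFloat IsRoundNearest)
open Literature.ComputerArithmetic.BoldoJeannerodMelquiondMuller2023 (roundTiesEven ulp ulp_of_ne_zero
  isRoundNearest_roundTiesEven roundTiesEven_of_tie roundTiesEven_eq_self)
open Literature.ComputerArithmetic.Shewchuk1997

/-! ### The witnesses, precision `p = j + 4` -/

/-- A one-component expansion is strongly nonoverlapping. -/
theorem isStrongExpansion_singleton (x : ℚ) : IsStrongExpansion [x] := by
  refine ⟨List.pairwise_singleton _ _, ?_⟩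
  intro y hy hy0 h1 _
  simp only [List.map_cons, List.map_nil, List.mem_cons, List.not_mem_nil, or_false] at hy h1
  subst hy
  exact hy0 (abs_eq_zero.mp (by linarith [abs_nonneg y]))

/-- `f = ⟨−(2^(p−1) − 1), −2^p⟩ = ⟨1 − 8·2^j, −16·2^j⟩` is even NONADJACENT (hence strongly
nonoverlapping): `−2^p ∈ 2^p·ℤ` and `2·(2^(p−1) − 1) < 2^p`. -/
theorem ceF_isExpansion_two (j : ℕ) :
    IsExpansion 2 [1 - 8 * (2 : ℚ) ^ j, -(16 * (2 : ℚ) ^ j)] := by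
  have ht1 : (1 : ℚ) ≤ 2 ^ j := one_le_pow₀ (by norm_num)
  show List.Pairwise _ _
  refine List.Pairwise.cons ?_ (List.pairwise_singleton _ _)
  intro y hy
  rw [List.mem_singleton.mp hy]
  refine ⟨(j : ℤ) + 4, ⟨-1, ?_⟩, ?_⟩
  · rw [zpow_add₀ (by norm_num : (2 : ℚ) ≠ 0), zpow_natCast]; push_cast; ring
  · rw [zpow_add₀ (by norm_num : (2 : ℚ) ≠ 0), zpow_natCast, abs_of_neg (by linarith)]
    norm_num; linarith

/-- The components of `e = ⟨2^p + 2⟩` are `p`-bit floats (`(2^(p−1) + 1)·2`). -/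
theorem ceE_isFloat (j : ℕ) {emin : ℤ} (hemin : emin ≤ 0) :
    ∀ x ∈ [16 * (2 : ℚ) ^ j + 2], IsFloat (j + 4) emin x := by
  intro x hx
  rw [List.mem_singleton.mp hx]
  have h1 : (1 : ℤ) ≤ 2 ^ j := one_le_pow₀ (by norm_num)
  refine ⟨8 * 2 ^ j + 1, 1, ?_, by omega, ?_⟩
  · rw [show (2 : ℤ) ^ (j + 4) = 16 * 2 ^ j by ring, abs_of_pos (by positivity)]; linarith
  · push_cast; ring

/-- The components of `f = ⟨−(2^(p−1) − 1), −2^p⟩` are `p`-bit floats. -/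
theorem ceF_isFloat (j : ℕ) {emin : ℤ} (hemin : emin ≤ 0) :
    ∀ x ∈ [1 - 8 * (2 : ℚ) ^ j, -(16 * (2 : ℚ) ^ j)], IsFloat (j + 4) emin x := by
  have h1 : (1 : ℤ) ≤ 2 ^ j := one_le_pow₀ (by norm_num)
  intro x hx
  simp only [List.mem_cons, List.not_mem_nil, or_false] at hx
  rcases hx with rfl | rfl
  · refine ⟨1 - 8 * 2 ^ j, 0, ?_, hemin, by push_cast; simp⟩
    rw [show (2 : ℤ) ^ (j + 4) = 16 * 2 ^ j by ring, abs_of_neg (by linarith)]; linarith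
  · refine ⟨-1, (j : ℤ) + 4, ?_, by omega, ?_⟩
    · rw [abs_neg, abs_one]; exact one_lt_pow₀ (by norm_num) (by omega)
    · rw [zpow_add₀ (by norm_num : (2 : ℚ) ≠ 0), zpow_natCast]; push_cast; ring

/-- THE TIE.  `Q₂ = g₂ ⊕ g₁ = RNₑ(−2^p − (2^(p−1) − 1)) = RNₑ(1 − 24·2^j)`: the argument
`−(3·2^(p−1) − 1)` lies exactly halfway between the consecutive `p`-bit floats `−3·2^(p−1)` and
`−(3·2^(p−1) − 2)` (`ulp = 2` in the binade `[2^p, 2^(p+1))`), and round-to-even picks the one with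
even scaled significand `−3·2^(p−2) = −12·2^j`, i.e. `Q₂ = −3·2^(p−1) = −24·2^j`. -/
theorem roundTiesEven_tie (j : ℕ) {emin : ℤ} (hemin : emin ≤ 1) :
    roundTiesEven (j + 4) emin (1 - 24 * 2 ^ j) = -(24 * 2 ^ j) := by
  have ht1 : (1 : ℚ) ≤ 2 ^ j := one_le_pow₀ (by norm_num)
  have hx0 : (1 - 24 * 2 ^ j : ℚ) ≠ 0 := by intro h; linarith
  have hpos : 0 < |(1 - 24 * 2 ^ j : ℚ)| := abs_pos.mpr hx0
  have habs : |(1 - 24 * 2 ^ j : ℚ)| = 24 * 2 ^ j - 1 := by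
    rw [abs_of_neg (by linarith)]; ring
  have h2 : (2 : ℚ) ≠ 0 := by norm_num
  have hlog : Int.log 2 |(1 - 24 * 2 ^ j : ℚ)| = (j : ℤ) + 4 := by
    apply le_antisymm
    · have hlt : |(1 - 24 * 2 ^ j : ℚ)| < ((2 : ℕ) : ℚ) ^ ((j : ℤ) + 4 + 1) := by
        rw [habs, Nat.cast_ofNat, zpow_add_one₀ h2, zpow_add₀ h2, zpow_natCast]; norm_num; linarith
      have := (Int.lt_zpow_iff_log_lt (b := 2) (by norm_num) hpos).mp hlt
      omega
    · have hle : ((2 : ℕ) : ℚ) ^ ((j : ℤ) + 4) ≤ |(1 - 24 * 2 ^ j : ℚ)| := by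
        rw [habs, Nat.cast_ofNat, zpow_add₀ h2, zpow_natCast]; norm_num; linarith
      exact (Int.zpow_le_iff_le_log (b := 2) (by norm_num) hpos).mp hle
  have hu : ulp (j + 4) emin (1 - 24 * 2 ^ j) = 2 := by
    rw [ulp_of_ne_zero hx0, hlog]
    have : (j : ℤ) + 4 - ((j + 4 : ℕ) : ℤ) + 1 = 1 := by push_cast; ring
    rw [this, max_eq_right hemin, zpow_one]
  have hN : ⌊(1 - 24 * 2 ^ j : ℚ) / 2⌋ = -12 * 2 ^ j := by
    rw [Int.floor_eq_iff]; push_cast; constructor <;> linarith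
  have htie : (1 - 24 * 2 ^ j : ℚ) -
        (⌊(1 - 24 * 2 ^ j : ℚ) / ulp (j + 4) emin (1 - 24 * 2 ^ j)⌋ : ℚ) *
          ulp (j + 4) emin (1 - 24 * 2 ^ j) =
      ((⌊(1 - 24 * 2 ^ j : ℚ) / ulp (j + 4) emin (1 - 24 * 2 ^ j)⌋ : ℚ) + 1) *
          ulp (j + 4) emin (1 - 24 * 2 ^ j) - (1 - 24 * 2 ^ j) := by
    rw [hu, hN]; push_cast; ring
  have heven : Even ⌊(1 - 24 * 2 ^ j : ℚ) / ulp (j + 4) emin (1 - 24 * 2 ^ j)⌋ := by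
    rw [hu, hN]; exact ⟨-6 * 2 ^ j, by ring⟩
  rw [roundTiesEven_of_tie htie, if_pos heven, hu, hN]; push_cast; ring

/-- FAST-EXPANSION-SUM on a merged sequence of exactly three components. -/
theorem fastExpansionSum_of_merge_three {fl : ℚ → ℚ} {e f : List ℚ} {g₁ g₂ g₃ : ℚ}
    (h : mergeExpansions e f = [g₁, g₂, g₃]) :
    fastExpansionSum fl e f =
      [(fastTwoSum fl g₂ g₁).2, (twoSum fl (fastTwoSum fl g₂ g₁).1 g₃).2,
        (twoSum fl (fastTwoSum fl g₂ g₁).1 g₃).1] := by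
  simp [fastExpansionSum, h]

/-- THE RUN (precision `p = j + 4 ≥ 4`, round-to-even, `emin ≤ 0`):
FAST-EXPANSION-SUM(`⟨2^p + 2⟩`, `⟨−(2^(p−1) − 1), −2^p⟩`) `= ⟨1, 0, −(2^(p−1) − 2)⟩`.
Line 1: `g = ⟨−(2^(p−1) − 1), −2^p, 2^p + 2⟩`; Line 2: `Q₂ = −3·2^(p−1)` (the tie above), `h₁ = 1`;
Line 4: `Q₂ + g₃ = −(2^(p−1) − 2)` is a float, so `Q₃ = −(2^(p−1) − 2)`, `h₂ = 0`; Line 5: `h₃ = Q₃`. -/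
theorem fastExpansionSum_ce (j : ℕ) {emin : ℤ} (hemin : emin ≤ 0) :
    fastExpansionSum (roundTiesEven (j + 4) emin)
      [16 * 2 ^ j + 2] [1 - 8 * 2 ^ j, -(16 * 2 ^ j)] = [1, 0, 2 - 8 * 2 ^ j] := by
  have hp : 1 ≤ j + 4 := by omega
  have hR := isRoundNearest_roundTiesEven (p := j + 4) (emin := emin) hp
  have ht1 : (1 : ℚ) ≤ 2 ^ j := one_le_pow₀ (by norm_num)
  have h1 : (1 : ℤ) ≤ 2 ^ j := one_le_pow₀ (by norm_num)
  have hmerge : mergeExpansions [16 * 2 ^ j + 2] [1 - 8 * 2 ^ j, -(16 * 2 ^ j)] =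
      [1 - 8 * 2 ^ j, -(16 * 2 ^ j), 16 * 2 ^ j + 2] := by
    rw [mergeExpansions_cons_cons, if_neg, mergeExpansions_cons_cons, if_neg,
      mergeExpansions_nil_right]
    · rw [abs_of_pos (by positivity), abs_of_neg (by linarith)]; linarith
    · rw [abs_of_pos (by positivity), abs_of_neg (by linarith)]; linarith
  have hg₁ : IsFloat (j + 4) emin (1 - 8 * 2 ^ j) := ceF_isFloat j hemin _ (by simp)
  have hg₂ : IsFloat (j + 4) emin (-(16 * 2 ^ j)) := ceF_isFloat j hemin _ (by simp)
  have hg₃ : IsFloat (j + 4) emin (16 * 2 ^ j + 2) := ceE_isFloat j hemin _ (by simp)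
  have hQ₂ : IsFloat (j + 4) emin (-(24 * 2 ^ j)) := by
    rw [← roundTiesEven_tie j (by omega : emin ≤ 1)]; exact (hR _).1
  have hQ₃ : IsFloat (j + 4) emin (2 - 8 * 2 ^ j) := by
    refine ⟨1 - 4 * 2 ^ j, 1, ?_, by omega, by push_cast; ring⟩
    rw [show (2 : ℤ) ^ (j + 4) = 16 * 2 ^ j by ring, abs_of_neg (by linarith)]; linarith
  have hle : |(1 - 8 * 2 ^ j : ℚ)| ≤ |(-(16 * 2 ^ j) : ℚ)| := by
    rw [abs_of_neg (by linarith), abs_of_neg (by linarith)]; linarith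
  rw [fastExpansionSum_of_merge_three hmerge]
  obtain ⟨h1fst, -, h1snd, -⟩ := fastTwoSum_exact hp hR hg₂ hg₁ hle
  have hsum₁ : (-(16 * 2 ^ j) + (1 - 8 * 2 ^ j) : ℚ) = 1 - 24 * 2 ^ j := by ring
  rw [hsum₁, roundTiesEven_tie j (by omega : emin ≤ 1)] at h1fst h1snd
  rw [h1fst, h1snd]
  obtain ⟨h2snd, -⟩ := twoSum_exact hp hR hQ₂ hg₃
  have hsum₂ : (-(24 * 2 ^ j) + (16 * 2 ^ j + 2) : ℚ) = 2 - 8 * 2 ^ j := by ring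
  rw [hsum₂, roundTiesEven_eq_self hp hQ₃] at h2snd
  rw [h2snd, twoSum_fst, hsum₂, roundTiesEven_eq_self hp hQ₃]
  have ha : (1 - 24 * 2 ^ j - -(24 * 2 ^ j) : ℚ) = 1 := by ring
  have hb : (2 - 8 * 2 ^ j - (2 - 8 * 2 ^ j) : ℚ) = 0 := by ring
  rw [ha, hb]

/-- THE OUTPUT IS NOT STRONGLY NONOVERLAPPING: in `⟨1, 0, −(2^(p−1) − 2)⟩` the nonzero components
`1` and `−(2^(p−1) − 2) = −(1 − 4·2^j)·2` are adjacent (`2·1` overlaps the bit `2` of the latter),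
and the latter is not a one-bit number (`p ≥ 4`). -/
theorem not_isStrongExpansion_ceH (j : ℕ) : ¬ IsStrongExpansion [1, 0, 2 - 8 * (2 : ℚ) ^ j] := by
  intro h
  have ht1 : (1 : ℚ) ≤ 2 ^ j := one_le_pow₀ (by norm_num)
  have h13 : StrongBelow 1 (2 - 8 * (2 : ℚ) ^ j) := (List.pairwise_cons.mp h.1).1 _ (by simp)
  rcases h13 with ⟨s, hs, hlt⟩ | ⟨a, ha, hc⟩
  · have hM : Odd (1 - 4 * 2 ^ j : ℤ) := ⟨-2 * 2 ^ j, by ring⟩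
    have hx : (2 - 8 * (2 : ℚ) ^ j) = ((1 - 4 * 2 ^ j : ℤ) : ℚ) * (2 : ℚ) ^ (1 : ℤ) := by
      push_cast; ring
    rw [hx] at hs
    have hs1 : s ≤ 1 := OnGrid.le_of_odd hM hs
    have h2s : (2 : ℚ) ^ s ≤ (2 : ℚ) ^ (1 : ℤ) := zpow_le_zpow_right₀ (by norm_num) hs1
    norm_num at hlt h2s
    linarith
  · have h1 : |((1 : ℤ) : ℚ) * (2 : ℚ) ^ (0 : ℤ)| = (2 : ℚ) ^ a := by rw [← ha]; norm_num
    have ha0 : a = 0 := (abs_eq_one_of_odd_of_abs_eq_two_zpow (by decide) h1).2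
    rw [ha0, zero_add, zpow_one, abs_of_neg (by linarith)] at hc
    linarith

/-- **Theorem 13 of [Shewchuk1997] is false as printed**, for every precision `p ≥ 4` and every
exponent floor `emin ≤ 0` (in particular with no underflow in sight): the strongly nonoverlapping —
indeed nonadjacent — inputs `e = ⟨2^p + 2⟩`, `f = ⟨−(2^(p−1) − 1), −2^p⟩` make FAST-EXPANSION-SUM under
round-to-even return `h = ⟨1, 0, −(2^(p−1) − 2)⟩`, which is nonoverlapping but NOT strongly
nonoverlapping. -/
theorem counterexample_family {p : ℕ} (hp : 4 ≤ p) {emin : ℤ} (hemin : emin ≤ 0) :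
    (∀ x ∈ [(2 : ℚ) ^ p + 2], IsFloat p emin x) ∧ IsStrongExpansion [(2 : ℚ) ^ p + 2] ∧
    (∀ x ∈ [-((2 : ℚ) ^ (p - 1) - 1), -(2 : ℚ) ^ p], IsFloat p emin x) ∧
    IsExpansion 2 [-((2 : ℚ) ^ (p - 1) - 1), -(2 : ℚ) ^ p] ∧
    fastExpansionSum (roundTiesEven p emin) [(2 : ℚ) ^ p + 2] [-((2 : ℚ) ^ (p - 1) - 1), -(2 : ℚ) ^ p]
      = [1, 0, -((2 : ℚ) ^ (p - 1) - 2)] ∧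
    ¬ IsStrongExpansion [1, 0, -((2 : ℚ) ^ (p - 1) - 2)] := by
  obtain ⟨j, rfl⟩ : ∃ j, p = j + 4 := ⟨p - 4, by omega⟩
  have h1 : (2 : ℚ) ^ (j + 4) = 16 * 2 ^ j := by ring
  have h2 : (2 : ℚ) ^ (j + 4 - 1) = 8 * 2 ^ j := by rw [show j + 4 - 1 = j + 3 by omega]; ring
  rw [h2, h1, show (-(8 * (2 : ℚ) ^ j - 1)) = 1 - 8 * 2 ^ j by ring,
    show (-(8 * (2 : ℚ) ^ j - 2)) = 2 - 8 * 2 ^ j by ring]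
  exact ⟨ceE_isFloat j hemin, isStrongExpansion_singleton _, ceF_isFloat j hemin,
    ceF_isExpansion_two j, fastExpansionSum_ce j hemin, not_isStrongExpansion_ceH j⟩

/-- **THE PRINTED CONCLUSION OF THEOREM 13 IS FALSE** for every `p ≥ 4` and `emin ≤ 0`: it is NOT
the case that for all strongly nonoverlapping expansions `e`, `f` of `p`-bit floats (such lists are
automatically "sorted in order of increasing magnitude, except that any component may be zero",
`IsStrongExpansion.pairwise_abs_le`) FAST-EXPANSION-SUM under round-to-even returns a STRONGLY
nonoverlapping expansion.  (The other printed conclusions — `h` nonoverlapping, increasing except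
zeros, `Σ h = e + f`, `m + n` components — do hold: `fastExpansionSum_nonoverlapping` in the
Literature file, for any round-to-nearest and `p ≥ 2`.) -/
theorem printedTheorem13_conclusion_false {p : ℕ} (hp : 4 ≤ p) {emin : ℤ} (hemin : emin ≤ 0) :
    ¬ ∀ e f : List ℚ, (∀ x ∈ e, IsFloat p emin x) → IsStrongExpansion e →
        (∀ x ∈ f, IsFloat p emin x) → IsStrongExpansion f →
        IsStrongExpansion (fastExpansionSum (roundTiesEven p emin) e f) := by
  intro h
  obtain ⟨heF, hes, hfF, hf2, hrun, hnot⟩ := counterexample_family hp hemin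
  exact hnot (hrun ▸ h _ _ heF hes hfF hf2.isStrongExpansion_of_two)

/-- The smallest instance, `p = 4` (the paper's running precision): `e = ⟨18⟩ = 10010`,
`f = ⟨−7, −16⟩ = −111 − 10000`, `h = ⟨1, 0, −6⟩` — `1` and `−110` are adjacent, `110` has two bits. -/
theorem counterexample_four {emin : ℤ} (hemin : emin ≤ 0) :
    fastExpansionSum (roundTiesEven 4 emin) [18] [-7, -16] = [1, 0, -6] ∧
      ¬ IsStrongExpansion [1, 0, -6] := by
  have h := fastExpansionSum_ce 0 hemin
  have h' := not_isStrongExpansion_ceH 0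
  norm_num at h h'
  exact ⟨h, h'⟩

/-- What DOES hold for these inputs (from the Literature file, any round-to-nearest): the output is a
nonoverlapping expansion with the right sum — here `⟨1, 0, −(2^(p−1) − 2)⟩` sums to
`e + f = 2^p + 2 − (2^(p−1) − 1) − 2^p = 3 − 2^(p−1)`. Recorded as a sanity check of the model. -/
theorem counterexample_family_nonoverlapping {p : ℕ} (hp : 4 ≤ p) {emin : ℤ} (hemin : emin ≤ 0) :
    IsExpansion 1 [1, 0, -((2 : ℚ) ^ (p - 1) - 2)] := by
  obtain ⟨heF, hes, hfF, hf2, hrun, -⟩ := counterexample_family hp hemin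
  rw [← hrun]
  exact (fastExpansionSum_nonoverlapping (by omega) (isRoundNearest_roundTiesEven (by omega))
    heF hes hfF hf2.isStrongExpansion_of_two).1

end Summit.Ventures.CertifiedArithmetic.Expansions
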